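import Mathlib.LinearAlgebra.QuadraticForm.Basic
import Mathlib.LinearAlgebra.Matrix.Trace
import Literature.Geometry.Lorentzian.PseudoRiemannianMetric
import HarnessLib

/-!
# The metric square norm `|T|²_g` in an orthogonal frame; positivity for Riemannian metrics

For a `C^n` pseudo-Riemannian metric `g` on a vector bundle `E → B` with finite-dimensional
model fibre, `Literature.Geometry.Lorentzian.PseudoRiemannianMetric.normSq g b T` is the metric
contraction `|T|²_g = T_{ij} T^{ij}` of a bilinear form `T` on the fibre `E b` (O'Neill,
*Semi-Riemannian geometry* (1983), Ch. 3, pp. 60–61), defined there as the trace of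
`(♯ ∘ T) ∘ (♯ ∘ Tᵗ)`. This file proves the frame formula behind the index notation and its
consequence for positive definite metrics:

* `trace_comp_eq_sum_sq` — for a bilinear form `q` with a `q`-orthogonal basis `b` of non-null
  vectors and endomorphisms `A, B` with `q(A v, w) = T(v, w)`, `q(B v, w) = T(w, v)`:
  `tr (A ∘ B) = ∑ᵢ ∑ⱼ T(bⱼ, bᵢ)² / (q(bᵢ,bᵢ) q(bⱼ,bⱼ))` (pure linear algebra);
* `PseudoRiemannianMetric.normSq_eq_sum_sq` — `|T|²_g = ∑ᵢ ∑ⱼ T(bⱼ,bᵢ)² / (g(bᵢ,bᵢ) g(bⱼ,bⱼ))`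
  in any `g_b`-orthogonal basis of non-null vectors (such bases exist,
  `LinearMap.BilinForm.exists_orthogonal_basis`);
* `PseudoRiemannianMetric.normSq_nonneg`, `normSq_pos`, `normSq_eq_zero_iff` — for a
  **Riemannian** metric (`g.IsRiemannian`), `|T|²_g ≥ 0`, with equality iff `T = 0`.

(For an indefinite metric `|T|²_g` has no sign, as the docstring of `normSq` records.) These are
the pointwise facts behind, e.g., `|k|²_h ≥ 0` in the Hamiltonian constraint and
`∫ ‖Ric‖²_h > 0` unless `Ric ≡ 0` in Schoen–Yau's proof of positive mass rigidity
(Comm. Math. Phys. 65 (1979), (3.30)).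

## References

* B. O'Neill, *Semi-Riemannian geometry with applications to relativity*, Academic Press 1983,
  Ch. 3, pp. 60–61 (metric contraction in a frame), Lemma 3.36.
-/

noncomputable section

open Manifold Bundle Module
open scoped ContDiff

namespace Literature.Geometry.Lorentzian

/-! ### Linear algebra: traces in an orthogonal basis -/

section Algebra

variable {V : Type*} [AddCommGroup V] [Module ℝ V]

/-- **Coordinates in an orthogonal basis.** If `b` is a `q`-orthogonal basis of non-null vectors,
the `i`-th coordinate of `v` is `q(v, bᵢ) / q(bᵢ, bᵢ)` (O'Neill 1983, Ch. 2, orthonormal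
expansion `v = ∑ εᵢ ⟨v, eᵢ⟩ eᵢ`, here without normalisation). [folklore] -/
theorem repr_eq_div_of_isOrthoᵢ {ι : Type*} [Fintype ι] [DecidableEq ι] (b : Basis ι ℝ V)
    {q : LinearMap.BilinForm ℝ V} (hb : q.IsOrthoᵢ b) (hc : ∀ i, q (b i) (b i) ≠ 0) (v : V)
    (i : ι) : b.repr v i = q v (b i) / q (b i) (b i) := by
  rw [eq_div_iff (hc i)]
  conv_rhs => rw [← b.sum_repr v]
  rw [map_sum, LinearMap.sum_apply, Finset.sum_eq_single i]
  · rw [map_smul, LinearMap.smul_apply, smul_eq_mul]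
  · intro j _ hji
    rw [map_smul, LinearMap.smul_apply, smul_eq_mul, hb hji, mul_zero]
  · intro hi
    exact absurd (Finset.mem_univ i) hi

/-- **Trace of a product of the two index-raisings of a bilinear form, in an orthogonal basis.**
Let `q` be a bilinear form on `V` with a `q`-orthogonal basis `b` of non-null vectors, `T` a
bilinear form, and `A, B` endomorphisms with `q(A v, w) = T(v, w)` and `q(B v, w) = T(w, v)`
(index raising of `T` and of its transpose). Then
`tr (A ∘ B) = ∑ᵢ ∑ⱼ T(bⱼ, bᵢ)² / (q(bᵢ,bᵢ) q(bⱼ,bⱼ))` — the frame formula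
`T_{ij} T^{ij} = ∑ T_{ji}² / (qᵢ qⱼ)` (O'Neill 1983, Ch. 3, pp. 60–61, metric contraction in a
frame). [folklore] -/
theorem trace_comp_eq_sum_sq {ι : Type*} [Fintype ι] [DecidableEq ι] (b : Basis ι ℝ V)
    {q : LinearMap.BilinForm ℝ V} (hb : q.IsOrthoᵢ b) (hc : ∀ i, q (b i) (b i) ≠ 0)
    (T : LinearMap.BilinForm ℝ V) (A B : V →ₗ[ℝ] V)
    (hA : ∀ v w, q (A v) w = T v w) (hB : ∀ v w, q (B v) w = T w v) :
    LinearMap.trace ℝ V (A ∘ₗ B) =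
      ∑ i, ∑ j, T (b j) (b i) ^ 2 / (q (b i) (b i) * q (b j) (b j)) := by
  classical
  have hcoord := repr_eq_div_of_isOrthoᵢ b hb hc
  rw [LinearMap.trace_eq_matrix_trace ℝ b, Matrix.trace]
  refine Finset.sum_congr rfl fun i _ ↦ ?_
  rw [Matrix.diag_apply, LinearMap.toMatrix_apply, hcoord, LinearMap.comp_apply]
  have hBi : B (b i) = ∑ j, (T (b j) (b i) / q (b j) (b j)) • b j := by
    conv_lhs => rw [← b.sum_repr (B (b i))]
    refine Finset.sum_congr rfl fun j _ ↦ ?_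
    rw [hcoord, hB]
  rw [hBi, map_sum, map_sum, LinearMap.sum_apply, Finset.sum_div]
  refine Finset.sum_congr rfl fun j _ ↦ ?_
  rw [map_smul, map_smul, LinearMap.smul_apply, smul_eq_mul, hA]
  field_simp

end Algebra

/-! ### The metric square norm in an orthogonal frame -/

namespace PseudoRiemannianMetric

variable
  {EB : Type*} [NormedAddCommGroup EB] [NormedSpace ℝ EB]
  {HB : Type*} [TopologicalSpace HB] {IB : ModelWithCorners ℝ EB HB} {n : ℕ∞ω}
  {B : Type*} [TopologicalSpace B] [ChartedSpace HB B]
  {F : Type*} [NormedAddCommGroup F] [NormedSpace ℝ F] [FiniteDimensional ℝ F]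
  {E : B → Type*} [TopologicalSpace (TotalSpace F E)]
  [∀ b, TopologicalSpace (E b)] [∀ b, AddCommGroup (E b)] [∀ b, Module ℝ (E b)]
  [FiberBundle F E] [VectorBundle ℝ F E]
  (g : PseudoRiemannianMetric IB n F E) (b : B)

/-- **Frame formula for the metric square norm**: in a `g_b`-orthogonal basis `e` of the fibre
consisting of non-null vectors, `|T|²_g = ∑ᵢ ∑ⱼ T(eⱼ, eᵢ)² / (g(eᵢ,eᵢ) g(eⱼ,eⱼ))` (the index
formula `T_{ij} T^{ij}` with `g^{ii} = 1/g(eᵢ,eᵢ)` in an orthogonal frame; `trace_comp_eq_sum_sq`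
with `A = ♯ ∘ T`, `B = ♯ ∘ Tᵗ`, `val_sharp_apply`). O'Neill 1983, Ch. 3, pp. 60–61. [folklore] -/
theorem normSq_eq_sum_sq {ι : Type*} [Fintype ι] [DecidableEq ι] (e : Basis ι ℝ (E b))
    (he : (g.toBilinForm b).IsOrthoᵢ e) (hc : ∀ i, g.val b (e i) (e i) ≠ 0)
    (T : LinearMap.BilinForm ℝ (E b)) :
    g.normSq b T = ∑ i, ∑ j, T (e j) (e i) ^ 2 / (g.val b (e i) (e i) * g.val b (e j) (e j)) := by
  have hA : ∀ v w, g.toBilinForm b (((g.sharp b).toLinearMap ∘ₗ T) v) w = T v w := by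
    intro v w
    simp
  have hB : ∀ v w, g.toBilinForm b (((g.sharp b).toLinearMap ∘ₗ T.flip) v) w = T w v := by
    intro v w
    simp
  exact trace_comp_eq_sum_sq e he hc T _ _ hA hB

/-- Every fibre carries a `g_b`-orthogonal basis, indexed by `Fin (dim)`, and for such a basis the
vectors are non-null (nondegeneracy). Mathlib's `LinearMap.BilinForm.exists_orthogonal_basis`
with `LinearMap.IsOrthoᵢ.not_isOrtho_basis_self_of_separatingLeft` (O'Neill 1983, Ch. 2:
every scalar product space has an orthonormal basis; here unnormalised). [folklore] -/
theorem exists_isOrthoᵢ_basis :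
    ∃ e : Basis (Fin (finrank ℝ (E b))) ℝ (E b),
      (g.toBilinForm b).IsOrthoᵢ e ∧ ∀ i, g.val b (e i) (e i) ≠ 0 := by
  haveI := VectorBundle.finiteDimensional ℝ F E b
  obtain ⟨e, he⟩ := LinearMap.BilinForm.exists_orthogonal_basis
    (LinearMap.BilinForm.isSymm_iff.1 (g.isSymm_toBilinForm b))
  exact ⟨e, he, fun i ↦ he.not_isOrtho_basis_self_of_separatingLeft
    (g.nondegenerate_toBilinForm b).1 i⟩

/-- For a **Riemannian** metric the metric square norm of a bilinear form on a fibre is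
nonnegative, and positive unless the form vanishes: in a `g_b`-orthogonal basis it is the sum of
squares `normSq_eq_sum_sq` with `g(eᵢ,eᵢ) > 0`. O'Neill 1983, Ch. 3, pp. 60–61. [folklore] -/
theorem normSq_nonneg_and_pos (hg : g.IsRiemannian) (T : LinearMap.BilinForm ℝ (E b)) :
    0 ≤ g.normSq b T ∧ (T ≠ 0 → 0 < g.normSq b T) := by
  classical
  obtain ⟨e, he, -⟩ := g.exists_isOrthoᵢ_basis b
  have hpos : ∀ i, 0 < g.val b (e i) (e i) := fun i ↦ hg b (e i) (e.ne_zero i)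
  have hn := g.normSq_eq_sum_sq b e he (fun i ↦ (hpos i).ne') T
  have hterm : ∀ i j, 0 ≤ T (e j) (e i) ^ 2 / (g.val b (e i) (e i) * g.val b (e j) (e j)) :=
    fun i j ↦ div_nonneg (sq_nonneg _) (mul_pos (hpos i) (hpos j)).le
  refine ⟨hn ▸ Finset.sum_nonneg fun i _ ↦ Finset.sum_nonneg fun j _ ↦ hterm i j, fun hT ↦ ?_⟩
  obtain ⟨i, j, hij⟩ : ∃ i j, T (e j) (e i) ≠ 0 := by
    by_contra hall
    push Not at hall
    exact hT (e.ext fun j ↦ e.ext fun i ↦ by simpa using hall i j)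
  rw [hn]
  refine lt_of_lt_of_le ?_ (Finset.single_le_sum (fun i _ ↦ Finset.sum_nonneg fun j _ ↦ hterm i j)
    (Finset.mem_univ i))
  refine lt_of_lt_of_le ?_ (Finset.single_le_sum (fun j _ ↦ hterm i j) (Finset.mem_univ j))
  exact div_pos (by positivity) (mul_pos (hpos i) (hpos j))

/-- For a Riemannian metric, `|T|²_g ≥ 0` for every bilinear form `T` on a fibre.
O'Neill 1983, Ch. 3, pp. 60–61. [folklore] -/
theorem normSq_nonneg (hg : g.IsRiemannian) (T : LinearMap.BilinForm ℝ (E b)) :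
    0 ≤ g.normSq b T :=
  (g.normSq_nonneg_and_pos b hg T).1

/-- For a Riemannian metric, `|T|²_g > 0` for every nonzero bilinear form `T` on a fibre.
O'Neill 1983, Ch. 3, pp. 60–61. [folklore] -/
theorem normSq_pos (hg : g.IsRiemannian) {T : LinearMap.BilinForm ℝ (E b)} (hT : T ≠ 0) :
    0 < g.normSq b T :=
  (g.normSq_nonneg_and_pos b hg T).2 hT

/-- The square norm of the zero form vanishes (any signature). [folklore] -/
@[simp]
theorem normSq_zero : g.normSq b 0 = 0 := by
  simp [normSq]

/-- For a Riemannian metric, `|T|²_g = 0` iff `T = 0`. O'Neill 1983, Ch. 3, pp. 60–61.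
[folklore] -/
theorem normSq_eq_zero_iff (hg : g.IsRiemannian) (T : LinearMap.BilinForm ℝ (E b)) :
    g.normSq b T = 0 ↔ T = 0 := by
  refine ⟨fun h ↦ ?_, fun h ↦ by rw [h, normSq_zero]⟩
  by_contra hT
  exact (g.normSq_pos b hg hT).ne' h

end PseudoRiemannianMetric

end Literature.Geometry.Lorentzian

end
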